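import Mathlib
import HarnessLib

/-!
# Path lifting for the orbit map of a finite group action

**Theorem** (`Literature.AlgebraicTopology.FundamentalGroup.OrbitMapPathLifting.exists_path_lift`).
Let a finite group `G` act by homeomorphisms (`ContinuousConstSMul`) on a Hausdorff space `X`,
and let `p : X → X/G` be the orbit map (Mathlib: `Quotient.mk (MulAction.orbitRel G X)`, the
orbit space `MulAction.orbitRel.Quotient G X` carrying the quotient topology). Then every path
`γ` in `X/G` lifts to `X`: for every `x₀` over `γ 0` there is a path `Γ` in `X` starting at `x₀`
with `p ∘ Γ = γ`.

This is R. Brown, *Topology and Groupoids* (2006), **11.1.4** (stated there for discontinuous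
actions on Hausdorff spaces; by 11.1.3 an action of a finite group on a Hausdorff space is
discontinuous), "taken in essence from" G. E. Bredon, *Introduction to Compact Transformation
Groups* (1972), Ch. II, Thm. 6.2 (Brown, p. 380). We follow Brown's printed proof:

* induction on the order of `G` (here: strong induction on `Nat.card G`, the inductive hypothesis
  being applied to stabilisers `G_z ⊊ G`, acting on the same space `X`);
* `exists_canonical_nhd` — Brown's *canonical neighbourhoods* (11.1.3 and p. 358): an open
  `G_z`-invariant `V ∋ z` with `g • V ∩ V = ∅` for `g ∉ G_z`; `exists_local_lift` — over the image
  of a canonical neighbourhood the orbit map factors through `X → X/G_z`, injectively, so paths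
  near `p z` lift by the inductive hypothesis ("we can identify `Ū_x` with `U_x/G_x`");
* `exists_lift_of_extensible` — Brown's set `S` of times up to which a lift exists and its
  supremum (we run Zorn's lemma on partial lifts ordered by extension, closing up a chain by the
  left-limit lemma `exists_tendsto_nhdsLT`, which replaces Brown's sequential gluing
  `aⁿ`, `gₙ • aⁿ⁺¹` on `[0, 1 - 1/n]`);
* the inductive step `exists_lift_Icc_aux`: the closed set `A` of times mapped into the image of
  the fixed-point set `F = X^G`, where the lift is forced, the complementary open intervals, each
  lifted "by starting at the mid-point … and working backwards and forwards"
  (`exists_lift_Ioo_component`), and continuity of the assembled lift at the points of `A`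
  (the tube lemma `exists_isOpen_mk_mem`: `p⁻¹ p[U] = U` for `U` invariant).

Everything here is proved; there are no named facts. The consequence for fundamental groups
(M. A. Armstrong, 1968) is in `OrbitSpaceFundamentalGroupProofs.lean`.

## References

* R. Brown, *Topology and Groupoids*, BookSurge (2006), §11.1, 11.1.2–11.1.4, pp. 358–361.
  [cite: Brown2006, 11.1.4]
* G. E. Bredon, *Introduction to Compact Transformation Groups*, Academic Press (1972), Ch. II,
  Thm. 6.2.
-/

noncomputable section

open Set Filter MulAction
open scoped Topology

namespace Literature.AlgebraicTopology.FundamentalGroup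

namespace OrbitMapPathLifting

universe u v

variable {G : Type u} [Group G] {X : Type v} [TopologicalSpace X] [MulAction G X]

/-! ### The orbit map -/

omit [TopologicalSpace X] in
/-- Two points have the same image in the orbit space iff they lie in one orbit. [folklore] -/
theorem mk_eq_mk_iff (x y : X) :
    (⟦x⟧ : orbitRel.Quotient G X) = ⟦y⟧ ↔ ∃ g : G, g • y = x :=
  ⟨fun h => mem_orbit_iff.1 (Quotient.exact h), fun h => Quotient.sound (mem_orbit_iff.2 h)⟩

omit [TopologicalSpace X] in
/-- The orbit map is constant on orbits. [folklore] -/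
theorem mk_smul_eq (g : G) (x : X) : (⟦g • x⟧ : orbitRel.Quotient G X) = ⟦x⟧ :=
  Quotient.sound (mem_orbit x g)

/-- **Tube lemma for the orbit map** (Brown, proof of 11.1.4, last paragraph: `p⁻¹ p[U] = U` for
an invariant open `U`): an open set containing a whole orbit contains the full preimage of an
open neighbourhood of the corresponding point of `X/G`. [cite: Brown2006, 11.1.4] -/
theorem exists_isOpen_mk_mem [Finite G] [ContinuousConstSMul G X] {W : Set X} (hW : IsOpen W)
    {z : X} (hz : ∀ g : G, g • z ∈ W) :
    ∃ O : Set (orbitRel.Quotient G X), IsOpen O ∧ (⟦z⟧ : orbitRel.Quotient G X) ∈ O ∧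
      ∀ x : X, (⟦x⟧ : orbitRel.Quotient G X) ∈ O → x ∈ W := by
  refine ⟨Quotient.mk _ '' ⋂ g : G, (g • ·) ⁻¹' W, ?_, ⟨z, mem_iInter.2 hz, rfl⟩, ?_⟩
  · exact (isOpenQuotientMap_quotientMk (Γ := G) (T := X)).isOpenMap _
      (isOpen_iInter_of_finite fun g => hW.preimage (continuous_const_smul g))
  · rintro x ⟨w, hw, hwx⟩
    obtain ⟨g, rfl⟩ := (mk_eq_mk_iff w x).1 hwx
    simpa using mem_iInter.1 hw g⁻¹

/-! ### Left limits of lifts exist -/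

/-- **Closing up a lift.** If `f` lifts `γ` continuously over `[c, a)` and `γ` is continuous on
`[c, a]`, then `f` has a left limit at `a` lying over `γ a` (the fibre is finite and Hausdorff
separated; by the tube lemma `f` eventually stays in small disjoint neighbourhoods of the fibre,
and by connectedness in one of them). This replaces the sequential gluing at the end of Brown's
"case `A = {1}`". [cite: Brown2006, 11.1.4] -/
theorem exists_tendsto_nhdsLT [Finite G] [ContinuousConstSMul G X] [T2Space X]
    {γ : ℝ → orbitRel.Quotient G X} {f : ℝ → X} {c a : ℝ} (hca : c < a)
    (hγ : ContinuousOn γ (Icc c a)) (hf : ContinuousOn f (Ico c a))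
    (hlift : ∀ t ∈ Ico c a, (⟦f t⟧ : orbitRel.Quotient G X) = γ t) :
    ∃ z : X, (⟦z⟧ : orbitRel.Quotient G X) = γ a ∧ Tendsto f (𝓝[<] a) (𝓝 z) := by
  obtain ⟨z₀, hz₀⟩ := Quotient.exists_rep (γ a)
  by_contra H
  push Not at H
  -- an open neighbourhood of each point of the fibre which `f` does not eventually enter
  have H' : ∀ s : X, (⟦s⟧ : orbitRel.Quotient G X) = γ a →
      ∃ N : Set X, IsOpen N ∧ s ∈ N ∧ f ⁻¹' N ∉ 𝓝[<] a := by
    intro s hs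
    have h := H s hs
    rw [tendsto_nhds] at h
    push Not at h
    exact h
  choose! N hNo hsN hN using H'
  -- pairwise disjoint open neighbourhoods of the points of the (finite) fibre
  obtain ⟨U, hU, hUd⟩ := (Set.finite_range fun g : G => g • z₀).t2_separation
  have hfib : ∀ g : G, (⟦g • z₀⟧ : orbitRel.Quotient G X) = γ a := fun g =>
    (mk_smul_eq g z₀).trans hz₀
  set V : X → Set X := fun s => N s ∩ U s with hV
  have hVo : ∀ g : G, IsOpen (V (g • z₀)) := fun g => (hNo _ (hfib g)).inter (hU _).2
  obtain ⟨O, hOo, hzO, hO⟩ := exists_isOpen_mk_mem (G := G) (W := ⋃ g : G, V (g • z₀))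
    (isOpen_iUnion hVo) (z := z₀) (fun g => mem_iUnion.2 ⟨g, hsN _ (hfib g), (hU _).1⟩)
  -- `γ t ∈ O` and `t ∈ [c, a)` for `t < a` close to `a`
  have h1 : ∀ᶠ t in 𝓝[<] a, γ t ∈ O := by
    have hc : ContinuousWithinAt γ (Iic a) a :=
      (continuousWithinAt_Icc_iff_Iic hca).1 (hγ a ⟨hca.le, le_rfl⟩)
    have hmem : γ ⁻¹' O ∈ 𝓝[Iic a] a := hc.preimage_mem_nhdsWithin (hOo.mem_nhds (hz₀ ▸ hzO))
    exact nhdsWithin_mono a Iio_subset_Iic_self hmem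
  have h2 : ∀ᶠ t in 𝓝[<] a, t ∈ Ico c a := Ico_mem_nhdsLT hca
  obtain ⟨t₀, ht₀a', ht₀⟩ := mem_nhdsLT_iff_exists_Ioo_subset.1 (h1.and h2)
  have ht₀a : t₀ < a := ht₀a'
  obtain ⟨t₁, ht₀₁, ht₁a⟩ := exists_between ht₀a
  have hW : ∀ t ∈ Ioo t₀ a, f t ∈ ⋃ g : G, V (g • z₀) := fun t ht =>
    hO _ (by rw [hlift t (ht₀ ht).2]; exact (ht₀ ht).1)
  obtain ⟨g₁, hg₁⟩ := mem_iUnion.1 (hW t₁ ⟨ht₀₁, ht₁a⟩)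
  -- by connectedness `f` maps `(t₀, a)` into the single piece `V (g₁ • z₀)`
  have hpre : IsPreconnected (f '' Ioo t₀ a) :=
    isPreconnected_Ioo.image f (hf.mono fun t ht => ⟨(ht₀ ht).2.1, ht.2⟩)
  have hsub : f '' Ioo t₀ a ⊆ V (g₁ • z₀) := by
    refine hpre.subset_left_of_subset_union (u := V (g₁ • z₀))
      (v := ⋃ (g : G) (_ : g • z₀ ≠ g₁ • z₀), V (g • z₀)) (hVo g₁)
      (isOpen_iUnion fun g => isOpen_iUnion fun _ => hVo g) ?_ ?_ ?_
    · rw [disjoint_iUnion_right]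
      intro g
      rw [disjoint_iUnion_right]
      intro hg
      have hd : Disjoint (U (g₁ • z₀)) (U (g • z₀)) := hUd ⟨g₁, rfl⟩ ⟨g, rfl⟩ (Ne.symm hg)
      exact hd.mono inter_subset_right inter_subset_right
    · rintro _ ⟨t, ht, rfl⟩
      obtain ⟨g, hg⟩ := mem_iUnion.1 (hW t ht)
      by_cases h : g • z₀ = g₁ • z₀
      · exact Or.inl (h ▸ hg)
      · exact Or.inr (mem_iUnion₂.2 ⟨g, h, hg⟩)
    · exact ⟨f t₁, ⟨t₁, ⟨ht₀₁, ht₁a⟩, rfl⟩, hg₁⟩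
  -- hence `f ⁻¹' N (g₁ • z₀)` is a left neighbourhood of `a`: contradiction
  refine hN (g₁ • z₀) (hfib g₁) (mem_of_superset (Ioo_mem_nhdsLT ht₀a) fun t ht => ?_)
  exact (hsub ⟨t, ht, rfl⟩).1

/-- Extending a lift over `[c, a)` by its left limit at `a` gives a map continuous on `[c, a]`.
[folklore] -/
theorem continuousOn_Icc_extend_of_tendsto {f : ℝ → X} {c a : ℝ} (hca : c < a)
    (hf : ContinuousOn f (Ico c a)) {z : X} (hz : Tendsto f (𝓝[<] a) (𝓝 z)) :
    ContinuousOn (fun t => if t < a then f t else z) (Icc c a) := by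
  intro t ht
  by_cases hta : t < a
  · have h1 : ContinuousWithinAt f (Icc c a) t := by
      refine (hf t ⟨ht.1, hta⟩).mono_of_mem_nhdsWithin ?_
      exact mem_nhdsWithin.2 ⟨Iio a, isOpen_Iio, hta, fun s hs => ⟨hs.2.1, hs.1⟩⟩
    refine h1.congr_of_eventuallyEq ?_ (if_pos hta)
    have : ∀ᶠ s in 𝓝[Icc c a] t, s < a :=
      mem_nhdsWithin_of_mem_nhds (isOpen_Iio.mem_nhds hta)
    exact this.mono fun s hs => if_pos hs
  · obtain rfl : t = a := le_antisymm ht.2 (not_lt.1 hta)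
    have key : Tendsto (fun s => if s < t then f s else z) (𝓝[<] t) (𝓝 z) :=
      hz.congr' (eventually_nhdsWithin_of_forall fun s hs => (if_pos hs).symm)
    rw [continuousWithinAt_Icc_iff_Iic hca, ← continuousWithinAt_Iio_iff_Iic, ContinuousWithinAt]
    convert key using 2
    exact if_neg (lt_irrefl t)

/-- Gluing two maps continuous on `[c, a]` and on `[a, b]` which agree at `a`. [folklore] -/
theorem continuousOn_Icc_glue {f g : ℝ → X} {c a b : ℝ} (hf : ContinuousOn f (Icc c a))
    (hg : ContinuousOn g (Icc a b)) (h : f a = g a) :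
    ContinuousOn (fun t => if t ≤ a then f t else g t) (Icc c b) := by
  refine ContinuousOn.if ?_ ?_ ?_
  · rintro t ⟨-, ht⟩
    have hfr : frontier {s : ℝ | s ≤ a} = {a} := frontier_Iic
    rw [hfr] at ht
    rw [mem_singleton_iff.1 ht, h]
  · have hcl : closure {s : ℝ | s ≤ a} = Iic a := closure_Iic a
    rw [hcl]
    exact hf.mono fun t ht => ⟨ht.1.1, ht.2⟩
  · have hcl : closure {s : ℝ | ¬s ≤ a} = Ici a := by
      rw [show {s : ℝ | ¬s ≤ a} = Ioi a from Set.ext fun _ => not_le]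
      exact closure_Ioi a
    rw [hcl]
    exact hg.mono fun t ht => ⟨ht.2, ht.1.2⟩

/-! ### Maximal partial lifts (Brown's `sup S` argument) -/

/-- **Lifting over an interval along which local extension is always possible** (Brown's case
"`A = {1}`": the set `S` of `s` such that `γ|[c,s]` lifts from `x₀` has supremum `d`, and a lift
on all of `[c, d]` exists). We use Zorn's lemma on partial lifts `(a, f)` ordered by extension;
a chain is bounded by the union of its members closed up at the supremum by
`exists_tendsto_nhdsLT`, and a maximal partial lift reaches `d` by the hypothesis `hext`.
[cite: Brown2006, 11.1.4] -/
theorem exists_lift_of_extensible [Finite G] [ContinuousConstSMul G X] [T2Space X]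
    {γ : ℝ → orbitRel.Quotient G X} {c d : ℝ} (hcd : c ≤ d) (hγ : ContinuousOn γ (Icc c d))
    {x₀ : X} (hx₀ : (⟦x₀⟧ : orbitRel.Quotient G X) = γ c)
    (hext : ∀ a ∈ Ico c d, ∀ z : X, (⟦z⟧ : orbitRel.Quotient G X) = γ a →
      ∃ a' ∈ Ioc a d, ∃ g : ℝ → X, ContinuousOn g (Icc a a') ∧ g a = z ∧
        ∀ t ∈ Icc a a', (⟦g t⟧ : orbitRel.Quotient G X) = γ t) :
    ∃ f : ℝ → X, ContinuousOn f (Icc c d) ∧ f c = x₀ ∧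
      ∀ t ∈ Icc c d, (⟦f t⟧ : orbitRel.Quotient G X) = γ t := by
  classical
  -- partial lifts: `(a, f)` with `f` a lift of `γ` over `[c, a]` from `x₀`
  let P : ℝ × (ℝ → X) → Prop := fun p => p.1 ∈ Icc c d ∧ ContinuousOn p.2 (Icc c p.1) ∧
    p.2 c = x₀ ∧ ∀ t ∈ Icc c p.1, (⟦p.2 t⟧ : orbitRel.Quotient G X) = γ t
  let r : {p // P p} → {p // P p} → Prop := fun p q => p.1.1 ≤ q.1.1 ∧ EqOn p.1.2 q.1.2 (Icc c p.1.1)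
  have base : P (c, fun _ => x₀) := ⟨⟨le_rfl, hcd⟩, continuousOn_const, rfl, fun t ht => by
    rw [show t = c from le_antisymm ht.2 ht.1]; exact hx₀⟩
  have htrans : ∀ {p q s : {p // P p}}, r p q → r q s → r p s := fun hpq hqs =>
    ⟨hpq.1.trans hqs.1, fun t ht => (hpq.2 ht).trans (hqs.2 ⟨ht.1, ht.2.trans hpq.1⟩)⟩
  -- every chain has an upper bound
  have hchain : ∀ C : Set {p // P p}, IsChain r C → ∃ ub, ∀ p ∈ C, r p ub := by
    intro C hC
    rcases C.eq_empty_or_nonempty with rfl | hne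
    · exact ⟨⟨_, base⟩, fun p hp => hp.elim⟩
    -- values in a chain are compatible
    have compat : ∀ p ∈ C, ∀ q ∈ C, ∀ t, t ∈ Icc c p.1.1 → t ∈ Icc c q.1.1 →
        p.1.2 t = q.1.2 t := by
      intro p hp q hq t htp htq
      by_cases hpq : p = q
      · rw [hpq]
      rcases hC hp hq hpq with h | h
      · exact h.2 htp
      · exact (h.2 htq).symm
    let T : Set ℝ := (fun p : {p // P p} => p.1.1) '' C
    have hTne : T.Nonempty := hne.image _
    have hTbdd : BddAbove T := ⟨d, by rintro _ ⟨p, -, rfl⟩; exact p.2.1.2⟩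
    have hcT : ∀ p ∈ C, c ≤ p.1.1 := fun p _ => p.2.1.1
    by_cases hmax : ∃ p ∈ C, p.1.1 = sSup T
    · -- the supremum is attained: that element bounds the chain
      obtain ⟨p, hp, hpA⟩ := hmax
      refine ⟨p, fun q hq => ?_⟩
      by_cases hqp : q = p
      · rw [hqp]; exact ⟨le_rfl, fun t _ => rfl⟩
      rcases hC hq hp hqp with h | h
      · exact h
      · have hle : q.1.1 ≤ p.1.1 := hpA ▸ le_csSup hTbdd ⟨q, hq, rfl⟩
        have heq : q.1.1 = p.1.1 := le_antisymm hle h.1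
        exact ⟨hle, fun t ht => (h.2 ⟨ht.1, heq ▸ ht.2⟩).symm⟩
    · -- the supremum `A` is not attained: glue the chain over `[c, A)` and close up at `A`
      push Not at hmax
      set A := sSup T with hA
      have hlt : ∀ p ∈ C, p.1.1 < A := fun p hp =>
        lt_of_le_of_ne (le_csSup hTbdd ⟨p, hp, rfl⟩) (hmax p hp)
      obtain ⟨p₀, hp₀⟩ := hne
      have hcA : c < A := (hcT p₀ hp₀).trans_lt (hlt p₀ hp₀)
      have hAd : A ≤ d := csSup_le hTne (by rintro _ ⟨p, -, rfl⟩; exact p.2.1.2)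
      -- the glued function
      let g : ℝ → X := fun t => if h : ∃ p ∈ C, t ≤ p.1.1 then h.choose.1.2 t else x₀
      have hg : ∀ p ∈ C, ∀ t ∈ Icc c p.1.1, g t = p.1.2 t := by
        intro p hp t ht
        have h : ∃ p ∈ C, t ≤ p.1.1 := ⟨p, hp, ht.2⟩
        show (if h : ∃ p ∈ C, t ≤ p.1.1 then h.choose.1.2 t else x₀) = p.1.2 t
        rw [dif_pos h]
        exact compat _ h.choose_spec.1 p hp t ⟨ht.1, h.choose_spec.2⟩ ht
      have hex : ∀ t ∈ Ico c A, ∃ p ∈ C, t < p.1.1 := by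
        intro t ht
        obtain ⟨_, ⟨p, hp, rfl⟩, htp⟩ := exists_lt_of_lt_csSup hTne ht.2
        exact ⟨p, hp, htp⟩
      have hgc : ContinuousOn g (Ico c A) := by
        intro t ht
        obtain ⟨p, hp, htp⟩ := hex t ht
        have h1 : ContinuousWithinAt g (Icc c p.1.1) t :=
          (p.2.2.1.congr (fun s hs => hg p hp s hs)) t ⟨ht.1, htp.le⟩
        refine h1.mono_of_mem_nhdsWithin (mem_nhdsWithin.2 ⟨Iio p.1.1, isOpen_Iio, htp, ?_⟩)
        exact fun s hs => ⟨hs.2.1, le_of_lt hs.1⟩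
      have hgl : ∀ t ∈ Ico c A, (⟦g t⟧ : orbitRel.Quotient G X) = γ t := by
        intro t ht
        obtain ⟨p, hp, htp⟩ := hex t ht
        rw [hg p hp t ⟨ht.1, htp.le⟩]
        exact p.2.2.2.2 t ⟨ht.1, htp.le⟩
      obtain ⟨z, hz, hgz⟩ := exists_tendsto_nhdsLT hcA (hγ.mono (Icc_subset_Icc_right hAd)) hgc hgl
      -- the closed-up lift over `[c, A]`
      have hP : P (A, fun t => if t < A then g t else z) := by
        refine ⟨⟨hcA.le, hAd⟩, continuousOn_Icc_extend_of_tendsto hcA hgc hgz, ?_, ?_⟩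
        · show (if c < A then g c else z) = x₀
          rw [if_pos hcA, hg p₀ hp₀ c ⟨le_rfl, hcT p₀ hp₀⟩]
          exact p₀.2.2.2.1
        · intro t ht
          show (⟦if t < A then g t else z⟧ : orbitRel.Quotient G X) = γ t
          split_ifs with h
          · exact hgl t ⟨ht.1, h⟩
          · rw [show t = A from le_antisymm ht.2 (not_lt.1 h)]
            exact hz
      refine ⟨⟨_, hP⟩, fun q hq => ⟨(hlt q hq).le, fun t ht => ?_⟩⟩
      show q.1.2 t = if t < A then g t else z
      rw [if_pos (ht.2.trans_lt (hlt q hq)), hg q hq t ht]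
  -- a maximal partial lift
  obtain ⟨⟨⟨a, f⟩, ⟨⟨hca, had⟩, hfc, hf₀, hfl⟩⟩, hmax⟩ := exists_maximal_of_chains_bounded hchain htrans
  -- it reaches `d`
  rcases had.eq_or_lt with rfl | had'
  · exact ⟨f, hfc, hf₀, hfl⟩
  exfalso
  obtain ⟨a', ⟨haa', ha'd⟩, g, hgc, hga, hgl⟩ := hext a ⟨hca, had'⟩ (f a) (hfl a ⟨hca, le_rfl⟩)
  have hP : P (a', fun t => if t ≤ a then f t else g t) := by
    refine ⟨⟨hca.trans haa'.le, ha'd⟩, continuousOn_Icc_glue hfc hgc hga.symm, ?_, ?_⟩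
    · show (if c ≤ a then f c else g c) = x₀
      rw [if_pos hca]; exact hf₀
    · intro t ht
      show (⟦if t ≤ a then f t else g t⟧ : orbitRel.Quotient G X) = γ t
      split_ifs with h
      · exact hfl t ⟨ht.1, h⟩
      · exact hgl t ⟨(not_le.1 h).le, ht.2⟩
  have h := hmax ⟨_, hP⟩ ⟨haa'.le, fun t ht => (if_pos ht.2).symm⟩
  exact absurd h.1 (not_le.2 haa')

/-! ### Canonical neighbourhoods and local lifting near a point with small stabiliser -/

/-- **Canonical neighbourhoods** (Brown 11.1.3 and p. 358): for an action of a finite group on a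
Hausdorff space, every point `z` has an open neighbourhood `V` which is invariant under the
stabiliser `G_z` and satisfies `g • V ∩ V = ∅` for every `g ∉ G_z`.
[cite: Brown2006, 11.1.3] -/
theorem exists_canonical_nhd [Finite G] [ContinuousConstSMul G X] [T2Space X] (z : X) :
    ∃ V : Set X, IsOpen V ∧ z ∈ V ∧ (∀ g ∈ stabilizer G z, ∀ v ∈ V, g • v ∈ V) ∧
      ∀ g : G, g ∉ stabilizer G z → ∀ v ∈ V, g • v ∉ V := by
  classical
  have hsep : ∀ g : G, g • z ≠ z → ∃ u u' : Set X, IsOpen u ∧ IsOpen u' ∧ z ∈ u ∧ g • z ∈ u' ∧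
      Disjoint u u' := fun g hg => t2_separation hg.symm
  choose! u u' hu hu' hzu hgu huu' using hsep
  -- Brown's `N`: `N ∩ g • N = ∅` for every `g` moving `z`
  let N : Set X := ⋂ g ∈ {g : G | g • z ≠ z}, (u g ∩ (g • ·) ⁻¹' u' g)
  have hNo : IsOpen N := Set.Finite.isOpen_biInter (Set.toFinite _) fun g hg =>
    (hu g hg).inter ((hu' g hg).preimage (continuous_const_smul g))
  have hN : ∀ x, x ∈ N ↔ ∀ g : G, g • z ≠ z → x ∈ u g ∧ g • x ∈ u' g := fun x => by
    simp only [N, mem_iInter, mem_setOf_eq, mem_inter_iff, mem_preimage]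
  have hzN : z ∈ N := (hN z).2 fun g hg => ⟨hzu g hg, hgu g hg⟩
  -- `V = ⋂_{h ∈ G_z} h⁻¹ • N`
  let V : Set X := ⋂ h ∈ (stabilizer G z : Set G), (h • ·) ⁻¹' N
  have hV : ∀ x, x ∈ V ↔ ∀ h ∈ stabilizer G z, h • x ∈ N := fun x => by
    simp only [V, mem_iInter, SetLike.mem_coe, mem_preimage]
  refine ⟨V, Set.Finite.isOpen_biInter (Set.toFinite _) fun h _ =>
    hNo.preimage (continuous_const_smul h), ?_, ?_, ?_⟩
  · exact (hV z).2 fun h hh => by rwa [mem_stabilizer_iff.1 hh]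
  · intro g hg v hv
    refine (hV _).2 fun h hh => ?_
    rw [← mul_smul]
    exact (hV v).1 hv (h * g) (mul_mem hh hg)
  · intro g hg v hv hgv
    have hg' : g • z ≠ z := fun h => hg (mem_stabilizer_iff.2 h)
    have h1 : v ∈ N := by simpa using (hV v).1 hv 1 (one_mem _)
    have h2 : g • v ∈ N := by simpa using (hV (g • v)).1 hgv 1 (one_mem _)
    exact (huu' g hg').le_bot ⟨((hN _).1 h2 g hg').1, ((hN _).1 h1 g hg').2⟩

/-- The action of a subgroup is again by homeomorphisms. [folklore] -/
theorem continuousConstSMul_subgroup [ContinuousConstSMul G X] (H : Subgroup G) :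
    ContinuousConstSMul H X :=
  ⟨fun h => continuous_const_smul (h : G)⟩

/-- **Local lifting near a point, from path lifting for its stabiliser** (Brown: "we can identify
`Ū_x` with the orbit space `(U_x)/G_x`"). If paths in `X/G_z` lift to `X`, then a path in `X/G`
starting at `p z` lifts over some initial segment, starting at `z`: on a canonical neighbourhood
`V` of `z` the orbit map `X → X/G` factors injectively and openly through `X → X/G_z`.
[cite: Brown2006, 11.1.4] -/
theorem exists_local_lift [Finite G] [ContinuousConstSMul G X] [T2Space X] {z : X}
    (hIH : ∀ (γ' : ℝ → orbitRel.Quotient (stabilizer G z) X) (a b : ℝ) (x : X),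
      ContinuousOn γ' (Icc a b) → (⟦x⟧ : orbitRel.Quotient (stabilizer G z) X) = γ' a →
      ∃ f : ℝ → X, ContinuousOn f (Icc a b) ∧ f a = x ∧
        ∀ t ∈ Icc a b, (⟦f t⟧ : orbitRel.Quotient (stabilizer G z) X) = γ' t)
    {γ : ℝ → orbitRel.Quotient G X} {a b : ℝ} (hab : a < b) (hγ : ContinuousOn γ (Icc a b))
    (hz : (⟦z⟧ : orbitRel.Quotient G X) = γ a) :
    ∃ a' ∈ Ioc a b, ∃ f : ℝ → X, ContinuousOn f (Icc a a') ∧ f a = z ∧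
      ∀ t ∈ Icc a a', (⟦f t⟧ : orbitRel.Quotient G X) = γ t := by
  classical
  set H := stabilizer G z with hH
  haveI : ContinuousConstSMul H X := continuousConstSMul_subgroup H
  obtain ⟨V, hVo, hzV, hVinv, hVdisj⟩ := exists_canonical_nhd (G := G) z
  -- a section `σ` of the orbit map over the image of `V`, with values in `V`
  let σ : orbitRel.Quotient G X → X := fun q =>
    if h : ∃ v ∈ V, (⟦v⟧ : orbitRel.Quotient G X) = q then h.choose else z
  have hσ : ∀ q, (∃ v ∈ V, (⟦v⟧ : orbitRel.Quotient G X) = q) →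
      σ q ∈ V ∧ (⟦σ q⟧ : orbitRel.Quotient G X) = q := by
    intro q h
    have hσq : σ q = h.choose := by simp only [σ, dif_pos h]
    rw [hσq]
    exact h.choose_spec
  -- two points of `V` in one `G`-orbit are in one `H`-orbit
  have horb : ∀ v ∈ V, ∀ w ∈ V, (⟦v⟧ : orbitRel.Quotient G X) = ⟦w⟧ →
      (⟦v⟧ : orbitRel.Quotient H X) = ⟦w⟧ := by
    intro v hv w hw h
    obtain ⟨g, rfl⟩ := (mk_eq_mk_iff v w).1 h
    have hg : g ∈ H := by
      by_contra hg
      exact hVdisj g hg w hw hv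
    exact (mk_eq_mk_iff _ _).2 ⟨⟨g, hg⟩, rfl⟩
  -- `ψ : p[V] → X/H`, the inverse of the factorisation `X/H → X/G` over `p[V]`
  let ψ : orbitRel.Quotient G X → orbitRel.Quotient H X := fun q => ⟦σ q⟧
  have hψ : ∀ v ∈ V, ψ ⟦v⟧ = ⟦v⟧ := fun v hv =>
    horb _ (hσ _ ⟨v, hv, rfl⟩).1 v hv (hσ _ ⟨v, hv, rfl⟩).2
  have hpV : IsOpen (Quotient.mk _ '' V : Set (orbitRel.Quotient G X)) :=
    (isOpenQuotientMap_quotientMk (Γ := G) (T := X)).isOpenMap _ hVo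
  have hψc : ContinuousOn ψ (Quotient.mk _ '' V) := by
    rw [continuousOn_open_iff hpV]
    intro O hO
    have : Quotient.mk _ '' V ∩ ψ ⁻¹' O =
        Quotient.mk _ '' (V ∩ (Quotient.mk (orbitRel H X)) ⁻¹' O) := by
      ext q
      constructor
      · rintro ⟨⟨v, hv, rfl⟩, hq⟩
        refine ⟨v, ⟨hv, ?_⟩, rfl⟩
        show (⟦v⟧ : orbitRel.Quotient H X) ∈ O
        rw [← hψ v hv]
        exact hq
      · rintro ⟨v, ⟨hv, hvO⟩, rfl⟩
        refine ⟨⟨v, hv, rfl⟩, ?_⟩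
        show ψ ⟦v⟧ ∈ O
        rw [hψ v hv]
        exact hvO
    rw [this]
    exact (isOpenQuotientMap_quotientMk (Γ := G) (T := X)).isOpenMap _
      (hVo.inter (hO.preimage continuous_quot_mk))
  -- an initial segment `[a, a']` mapped by `γ` into `p[V]`
  have hmem : γ ⁻¹' (Quotient.mk _ '' V) ∈ 𝓝[Icc a b] a :=
    (hγ a ⟨le_rfl, hab.le⟩).preimage_mem_nhdsWithin (hpV.mem_nhds (hz ▸ ⟨z, hzV, rfl⟩))
  rw [nhdsWithin_Icc_eq_nhdsGE hab] at hmem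
  obtain ⟨u, hau, hu⟩ := mem_nhdsGE_iff_exists_Icc_subset.1 hmem
  set a' := min u b with ha'
  have haa' : a < a' := lt_min hau hab
  have hsub : ∀ t ∈ Icc a a', γ t ∈ (Quotient.mk _ '' V : Set (orbitRel.Quotient G X)) :=
    fun t ht => hu ⟨ht.1, ht.2.trans (min_le_left _ _)⟩
  -- lift `ψ ∘ γ` through `X → X/H` by the inductive hypothesis
  have hγ' : ContinuousOn (ψ ∘ γ) (Icc a a') :=
    hψc.comp (hγ.mono (Icc_subset_Icc_right (min_le_right _ _))) hsub
  obtain ⟨f, hfc, hfa, hfl⟩ := hIH (ψ ∘ γ) a a' z hγ' (by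
    show (⟦z⟧ : orbitRel.Quotient H X) = ψ (γ a)
    rw [← hz, hψ z hzV])
  refine ⟨a', ⟨haa', min_le_right _ _⟩, f, hfc, hfa, fun t ht => ?_⟩
  -- `f t` and `σ (γ t)` are in one `H`-orbit, so `p (f t) = p (σ (γ t)) = γ t`
  obtain ⟨v, hv, hvt⟩ := hsub t ht
  have h1 : (⟦f t⟧ : orbitRel.Quotient H X) = ⟦σ (γ t)⟧ := hfl t ht
  obtain ⟨h, hh⟩ := (mk_eq_mk_iff _ _).1 h1
  rw [← hh, show (h • σ (γ t) : X) = (h : G) • σ (γ t) from rfl, mk_smul_eq]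
  exact (hσ _ ⟨v, hv, hvt⟩).2

/-! ### Lifting over one complementary interval -/

/-- **Lifting over an interval free of fixed-point values**, "by starting at the mid-point … and
working backwards and forwards" (Brown): if local lifting (for the stabilisers of all points
over `γ (l, r)`) is available at every interior time, then `γ|[l, r]` lifts, with any prescribed
starting point over `γ l`. The backward half is the forward construction for the reversed path.
[cite: Brown2006, 11.1.4] -/
theorem exists_lift_Ioo_component [Finite G] [ContinuousConstSMul G X] [T2Space X]
    {γ : ℝ → orbitRel.Quotient G X} {l r : ℝ} (hlr : l < r) (hγ : ContinuousOn γ (Icc l r))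
    (hIH : ∀ s ∈ Ioo l r, ∀ z : X, (⟦z⟧ : orbitRel.Quotient G X) = γ s →
      ∀ (γ' : ℝ → orbitRel.Quotient (stabilizer G z) X) (a b : ℝ) (x : X),
      ContinuousOn γ' (Icc a b) → (⟦x⟧ : orbitRel.Quotient (stabilizer G z) X) = γ' a →
      ∃ f : ℝ → X, ContinuousOn f (Icc a b) ∧ f a = x ∧
        ∀ t ∈ Icc a b, (⟦f t⟧ : orbitRel.Quotient (stabilizer G z) X) = γ' t)
    {x₀ : X} (hx₀ : (⟦x₀⟧ : orbitRel.Quotient G X) = γ l) :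
    ∃ f : ℝ → X, ContinuousOn f (Icc l r) ∧ f l = x₀ ∧
      ∀ t ∈ Icc l r, (⟦f t⟧ : orbitRel.Quotient G X) = γ t := by
  set m := (l + r) / 2 with hm
  have hlm : l < m := by rw [hm]; linarith
  have hmr : m < r := by rw [hm]; linarith
  obtain ⟨zm, hzm⟩ := Quotient.exists_rep (γ m)
  -- forwards over `[m, r]`
  obtain ⟨f₂, hf₂c, hf₂m, hf₂l⟩ : ∃ f : ℝ → X, ContinuousOn f (Icc m r) ∧ f m = zm ∧
      ∀ t ∈ Icc m r, (⟦f t⟧ : orbitRel.Quotient G X) = γ t := by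
    refine exists_lift_of_extensible hmr.le (hγ.mono (Icc_subset_Icc_left hlm.le)) hzm ?_
    intro a ha z hz
    obtain ⟨a', ha', f, hf⟩ := exists_local_lift (hIH a ⟨hlm.trans_le ha.1, ha.2⟩ z hz) ha.2
      (hγ.mono (Icc_subset_Icc_left (hlm.le.trans ha.1))) hz
    exact ⟨a', ha', f, hf⟩
  -- backwards over `[l, m]`: forwards for the reversed path on `[-m, -l]`
  have hγR : ContinuousOn (fun t => γ (-t)) (Icc (-m) (-l)) :=
    hγ.comp continuous_neg.continuousOn fun t ht => ⟨by linarith [ht.2], by linarith [ht.1, hmr]⟩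
  obtain ⟨fR, hfRc, hfRm, hfRl⟩ : ∃ f : ℝ → X, ContinuousOn f (Icc (-m) (-l)) ∧ f (-m) = zm ∧
      ∀ t ∈ Icc (-m) (-l), (⟦f t⟧ : orbitRel.Quotient G X) = γ (-t) := by
    refine exists_lift_of_extensible (γ := fun t => γ (-t)) (by linarith) hγR
      (by rw [neg_neg]; exact hzm) ?_
    intro a ha z hz
    have ha' : -a ∈ Ioo l r := ⟨by linarith [ha.2], by linarith [ha.1, hmr]⟩
    obtain ⟨a', ha'', f, hf⟩ := exists_local_lift (γ := fun t => γ (-t)) (hIH (-a) ha' z hz) ha.2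
      (hγR.mono (Icc_subset_Icc_left ha.1)) hz
    exact ⟨a', ha'', f, hf⟩
  -- glue at `m`
  let F : ℝ → X := fun t => if t ≤ m then fR (-t) else f₂ t
  have hF : ContinuousOn F (Icc l r) := by
    refine continuousOn_Icc_glue (f := fun t => fR (-t)) ?_ hf₂c (by
      show fR (-m) = f₂ m
      rw [hfRm, hf₂m])
    exact hfRc.comp continuous_neg.continuousOn fun t ht => ⟨by linarith [ht.2], by linarith [ht.1]⟩
  have hFl : ∀ t ∈ Icc l r, (⟦F t⟧ : orbitRel.Quotient G X) = γ t := by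
    intro t ht
    show (⟦if t ≤ m then fR (-t) else f₂ t⟧ : orbitRel.Quotient G X) = γ t
    split_ifs with h
    · have := hfRl (-t) ⟨by linarith, by linarith [ht.1]⟩
      rwa [neg_neg] at this
    · exact hf₂l t ⟨(not_le.1 h).le, ht.2⟩
  -- translate so as to start at `x₀`
  obtain ⟨g, hg⟩ := (mk_eq_mk_iff _ _).1 (hx₀.trans (hFl l ⟨le_rfl, hlr.le⟩).symm)
  refine ⟨fun t => g • F t, (continuous_const_smul g).comp_continuousOn hF, hg, fun t ht => ?_⟩
  rw [mk_smul_eq]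
  exact hFl t ht

/-! ### The theorem -/

/-- The set of fixed points of the action is closed (Hausdorff space). [folklore] -/
theorem isClosed_fixedPoints [ContinuousConstSMul G X] [T2Space X] :
    IsClosed (fixedPoints G X) := by
  have : fixedPoints G X = ⋂ g : G, {x | g • x = x} := by
    ext x; simp [mem_fixedPoints]
  rw [this]
  exact isClosed_iInter fun g => isClosed_eq (continuous_const_smul g) continuous_id

/-- The image of the fixed-point set in the orbit space is closed: its complement is the (open)
image of the (open, invariant) complement. [cite: Brown2006, 11.1.4] -/
theorem isClosed_image_fixedPoints [ContinuousConstSMul G X] [T2Space X] :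
    IsClosed (Quotient.mk _ '' fixedPoints G X : Set (orbitRel.Quotient G X)) := by
  have : (Quotient.mk _ '' fixedPoints G X : Set (orbitRel.Quotient G X))ᶜ =
      Quotient.mk _ '' (fixedPoints G X)ᶜ := by
    ext q
    induction q using Quotient.inductionOn with | h x => ?_
    constructor
    · intro hq
      exact ⟨x, fun hx => hq ⟨x, hx, rfl⟩, rfl⟩
    · rintro ⟨y, hy, hyx⟩ ⟨w, hw, hwx⟩
      obtain ⟨g, rfl⟩ := (mk_eq_mk_iff _ _).1 (hyx.trans hwx.symm)
      exact hy (by rw [mem_fixedPoints.1 hw g]; exact hw)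
  rw [← isOpen_compl_iff, this]
  exact (isOpenQuotientMap_quotientMk (Γ := G) (T := X)).isOpenMap _ isClosed_fixedPoints.isOpen_compl

/-- **Path lifting for orbit maps of finite group actions — the induction on `|G|`** (Brown
11.1.4). For every finite group `G` of order `n` acting by homeomorphisms on a Hausdorff space
`X`, every map `γ : [c, d] → X/G` and every `x₀` over `γ c`, there is a continuous lift
`f : [c, d] → X` of `γ` with `f c = x₀`. [cite: Brown2006, 11.1.4] -/
theorem exists_lift_Icc_aux (n : ℕ) : ∀ (G : Type u) [Group G] [Finite G], Nat.card G = n →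
    ∀ (X : Type v) [TopologicalSpace X] [T2Space X] [MulAction G X] [ContinuousConstSMul G X]
      (γ : ℝ → orbitRel.Quotient G X) (c d : ℝ) (x₀ : X), ContinuousOn γ (Icc c d) →
      (⟦x₀⟧ : orbitRel.Quotient G X) = γ c →
      ∃ f : ℝ → X, ContinuousOn f (Icc c d) ∧ f c = x₀ ∧
        ∀ t ∈ Icc c d, (⟦f t⟧ : orbitRel.Quotient G X) = γ t := by
  induction n using Nat.strong_induction_on with
  | _ n ih =>
  intro G _ _ hn X _ _ _ _ γ c d x₀ hγ hx₀
  classical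
  haveI : Nonempty X := ⟨x₀⟩
  -- degenerate intervals
  rcases le_or_gt d c with hdc | hcd
  · refine ⟨fun _ => x₀, continuousOn_const, rfl, fun t ht => ?_⟩
    rw [show t = c from le_antisymm (ht.2.trans hdc) ht.1]
    exact hx₀
  -- the inductive hypothesis, for stabilisers of non-fixed points
  have hIH : ∀ z : X, z ∉ fixedPoints G X →
      ∀ (γ' : ℝ → orbitRel.Quotient (stabilizer G z) X) (a b : ℝ) (x : X),
      ContinuousOn γ' (Icc a b) → (⟦x⟧ : orbitRel.Quotient (stabilizer G z) X) = γ' a →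
      ∃ f : ℝ → X, ContinuousOn f (Icc a b) ∧ f a = x ∧
        ∀ t ∈ Icc a b, (⟦f t⟧ : orbitRel.Quotient (stabilizer G z) X) = γ' t := by
    intro z hz
    have hne : stabilizer G z ≠ ⊤ := by
      intro htop
      exact hz (mem_fixedPoints.2 fun g => mem_stabilizer_iff.1 (htop ▸ Subgroup.mem_top g))
    have hlt : Nat.card (stabilizer G z) < n :=
      hn ▸ lt_of_not_ge fun hle => hne (Subgroup.eq_top_of_le_card _ hle)
    haveI : ContinuousConstSMul (stabilizer G z) X := continuousConstSMul_subgroup _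
    exact ih _ hlt (stabilizer G z) rfl X
  -- clamp `γ` to a map continuous on all of `ℝ`
  let γb : ℝ → orbitRel.Quotient G X := fun t => γ (max c (min t d))
  have hcl : ∀ t, max c (min t d) ∈ Icc c d := fun t =>
    ⟨le_max_left _ _, max_le hcd.le (min_le_right _ _)⟩
  have hγb : Continuous γb :=
    hγ.comp_continuous (continuous_const.max (continuous_id.min continuous_const)) hcl
  have hγb_eq : ∀ t ∈ Icc c d, γb t = γ t := fun t ht => by
    show γ (max c (min t d)) = γ t
    rw [min_eq_left ht.2, max_eq_right ht.1]
  -- the closed set `B`: times mapped into `p[F]`, together with everything far outside `[c, d]`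
  set PF : Set (orbitRel.Quotient G X) := Quotient.mk _ '' fixedPoints G X with hPF
  let B : Set ℝ := γb ⁻¹' PF ∪ (Iic (c - 1) ∪ Ici (d + 1))
  have hBc : IsClosed B :=
    (isClosed_image_fixedPoints.preimage hγb).union (isClosed_Iic.union isClosed_Ici)
  -- the component `(L t, R t)` of the complement of `B` containing `t ∉ B`
  let L : ℝ → ℝ := fun t => sSup (B ∩ Iic t)
  let R : ℝ → ℝ := fun t => sInf (B ∩ Ici t)
  have hBlo : ∀ t, t ∉ B → c - 1 < t := fun t ht => by
    by_contra h; exact ht (Or.inr (Or.inl (not_lt.1 h)))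
  have hBhi : ∀ t, t ∉ B → t < d + 1 := fun t ht => by
    by_contra h; exact ht (Or.inr (Or.inr (not_lt.1 h)))
  have hLne : ∀ t, t ∉ B → (B ∩ Iic t).Nonempty := fun t ht =>
    ⟨c - 1, Or.inr (Or.inl self_mem_Iic), (hBlo t ht).le⟩
  have hRne : ∀ t, t ∉ B → (B ∩ Ici t).Nonempty := fun t ht =>
    ⟨d + 1, Or.inr (Or.inr self_mem_Ici), (hBhi t ht).le⟩
  have hLbdd : ∀ t, BddAbove (B ∩ Iic t) := fun t => ⟨t, fun s hs => hs.2⟩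
  have hRbdd : ∀ t, BddBelow (B ∩ Ici t) := fun t => ⟨t, fun s hs => hs.2⟩
  have hLmem : ∀ t, t ∉ B → L t ∈ B ∧ L t < t := fun t ht => by
    have h := (hBc.inter isClosed_Iic).csSup_mem (hLne t ht) (hLbdd t)
    refine ⟨h.1, lt_of_le_of_ne h.2 fun he => ht (he ▸ h.1)⟩
  have hRmem : ∀ t, t ∉ B → R t ∈ B ∧ t < R t := fun t ht => by
    have h := (hBc.inter isClosed_Ici).csInf_mem (hRne t ht) (hRbdd t)
    refine ⟨h.1, lt_of_le_of_ne h.2 fun he => ht (he.symm ▸ h.1)⟩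
  have hgap : ∀ t, t ∉ B → ∀ s ∈ Ioo (L t) (R t), s ∉ B := by
    intro t ht s hs hsB
    rcases le_total s t with hst | hts
    · exact absurd (le_csSup (hLbdd t) ⟨hsB, hst⟩) (not_le.2 hs.1)
    · exact absurd (csInf_le (hRbdd t) ⟨hsB, hts⟩) (not_le.2 hs.2)
  have hcL : ∀ t, t ∉ B → c - 1 ≤ L t := fun t ht =>
    le_csSup (hLbdd t) ⟨Or.inr (Or.inl self_mem_Iic), (hBlo t ht).le⟩
  have hRd : ∀ t, t ∉ B → R t ≤ d + 1 := fun t ht =>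
    csInf_le (hRbdd t) ⟨Or.inr (Or.inr self_mem_Ici), (hBhi t ht).le⟩
  have hLR : ∀ t, t ∉ B → ∀ s ∈ Ioo (L t) (R t), L s = L t ∧ R s = R t := by
    intro t ht s hs
    have hsB : s ∉ B := hgap t ht s hs
    refine ⟨le_antisymm ?_ ?_, le_antisymm ?_ ?_⟩
    · refine csSup_le (hLne s hsB) fun x hx => ?_
      by_contra h
      exact hgap t ht x ⟨not_le.1 h, hx.2.trans_lt hs.2⟩ hx.1
    · exact le_csSup (hLbdd s) ⟨(hLmem t ht).1, hs.1.le⟩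
    · exact csInf_le (hRbdd s) ⟨(hRmem t ht).1, hs.2.le⟩
    · refine le_csInf (hRne s hsB) fun x hx => ?_
      by_contra h
      exact hgap t ht x ⟨hs.1.trans_le hx.2, not_le.1 h⟩ hx.1
  -- a lift over each component
  have hcomp : ∀ l' r' : ℝ, l' < r' → (∀ s ∈ Ioo l' r', s ∉ B) →
      ∃ f : ℝ → X, ContinuousOn f (Icc l' r') ∧
        ∀ t ∈ Icc l' r', (⟦f t⟧ : orbitRel.Quotient G X) = γb t := by
    intro l' r' hlr hI
    obtain ⟨x, hx⟩ := Quotient.exists_rep (γb l')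
    obtain ⟨f, hf, -, hfl⟩ := exists_lift_Ioo_component hlr hγb.continuousOn
      (fun s hs z hz => hIH z fun hzF => hI s hs (Or.inl ⟨z, hzF, hz⟩)) hx
    exact ⟨f, hf, hfl⟩
  choose! Φ hΦc hΦl using hcomp
  -- the forced lift on `B`
  have hforced : ∀ q : orbitRel.Quotient G X, q ∈ PF → ∃ x ∈ fixedPoints G X,
      (⟦x⟧ : orbitRel.Quotient G X) = q := fun q hq => hq
  choose! e heF hemk using hforced
  -- the assembled lift
  let Λ : ℝ → X := fun t => if t ∈ B then e (γb t) else Φ (L t) (R t) t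
  have hmemB : ∀ t ∈ B, t ∈ Ioo (c - 1) (d + 1) → γb t ∈ PF := by
    rintro t (h | h | h) ht
    · exact h
    · exact absurd ht.1 (not_lt.2 h)
    · exact absurd ht.2 (not_lt.2 h)
  have hΛl : ∀ t ∈ Ioo (c - 1) (d + 1), (⟦Λ t⟧ : orbitRel.Quotient G X) = γb t := by
    intro t ht
    show (⟦if t ∈ B then e (γb t) else Φ (L t) (R t) t⟧ : orbitRel.Quotient G X) = γb t
    split_ifs with h
    · exact hemk _ (hmemB t h ht)
    · exact hΦl (L t) (R t) ((hLmem t h).2.trans (hRmem t h).2) (hgap t h) t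
        ⟨(hLmem t h).2.le, (hRmem t h).2.le⟩
  have hΛc : ∀ t ∈ Ioo (c - 1) (d + 1), ContinuousAt Λ t := by
    intro t ht
    by_cases htB : t ∈ B
    · -- a point of `A`: continuity is automatic (tube lemma around the fixed point `Λ t`)
      have hq : γb t ∈ PF := hmemB t htB ht
      have hΛt : Λ t = e (γb t) := if_pos htB
      rw [ContinuousAt, tendsto_nhds]
      intro W hWo hW
      rw [hΛt] at hW
      obtain ⟨O, hOo, hO, hOW⟩ := exists_isOpen_mk_mem (G := G) hWo (z := e (γb t))
        (fun g => by rw [mem_fixedPoints.1 (heF _ hq) g]; exact hW)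
      have h1 : ∀ᶠ s in 𝓝 t, γb s ∈ O :=
        hγb.continuousAt.preimage_mem_nhds (hOo.mem_nhds (by rw [← hemk _ hq]; exact hO))
      have h2 : ∀ᶠ s in 𝓝 t, s ∈ Ioo (c - 1) (d + 1) := isOpen_Ioo.mem_nhds ht
      exact (h1.and h2).mono fun s hs => hOW _ (by rw [hΛl s hs.2]; exact hs.1)
    · -- a point off `A`: `Λ` agrees with one component lift near `t`
      have hJ : Ioo (L t) (R t) ∈ 𝓝 t := isOpen_Ioo.mem_nhds ⟨(hLmem t htB).2, (hRmem t htB).2⟩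
      have hc : ContinuousAt (Φ (L t) (R t)) t :=
        (hΦc (L t) (R t) ((hLmem t htB).2.trans (hRmem t htB).2) (hgap t htB)).continuousAt
          (Icc_mem_nhds (hLmem t htB).2 (hRmem t htB).2)
      refine hc.congr (Filter.eventuallyEq_of_mem hJ fun s hs => ?_)
      show Φ (L t) (R t) s = if s ∈ B then e (γb s) else Φ (L s) (R s) s
      rw [if_neg (hgap t htB s hs), (hLR t htB s hs).1, (hLR t htB s hs).2]
  -- restrict to `[c, d]` and translate so as to start at `x₀`
  have hcd' : Icc c d ⊆ Ioo (c - 1) (d + 1) := fun t ht => ⟨by linarith [ht.1], by linarith [ht.2]⟩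
  have hΛc' : ContinuousOn Λ (Icc c d) :=
    continuousOn_of_forall_continuousAt fun t ht => hΛc t (hcd' ht)
  have hΛc0 : (⟦Λ c⟧ : orbitRel.Quotient G X) = ⟦x₀⟧ := by
    rw [hΛl c (hcd' ⟨le_rfl, hcd.le⟩), hγb_eq c ⟨le_rfl, hcd.le⟩, hx₀]
  obtain ⟨g, hg⟩ := (mk_eq_mk_iff _ _).1 hΛc0.symm
  refine ⟨fun t => g • Λ t, (continuous_const_smul g).comp_continuousOn hΛc', hg, fun t ht => ?_⟩
  rw [mk_smul_eq, hΛl t (hcd' ht), hγb_eq t ht]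

/-- **Path lifting for the orbit map of a finite group action, interval form** (Brown 11.1.4,
Bredon II.6.2): for a finite group `G` acting by homeomorphisms on a Hausdorff space `X`, a map
`γ` continuous on `[c, d]` with values in `X/G` and a point `x₀` over `γ c`, there is a lift
`f : ℝ → X`, continuous on `[c, d]`, with `f c = x₀` and `p ∘ f = γ` on `[c, d]`.
[cite: Brown2006, 11.1.4] -/
theorem exists_lift_Icc [Finite G] [ContinuousConstSMul G X] [T2Space X]
    (γ : ℝ → orbitRel.Quotient G X) {c d : ℝ} (hγ : ContinuousOn γ (Icc c d)) {x₀ : X}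
    (hx₀ : (⟦x₀⟧ : orbitRel.Quotient G X) = γ c) :
    ∃ f : ℝ → X, ContinuousOn f (Icc c d) ∧ f c = x₀ ∧
      ∀ t ∈ Icc c d, (⟦f t⟧ : orbitRel.Quotient G X) = γ t :=
  exists_lift_Icc_aux _ G rfl X γ c d x₀ hγ hx₀

/-- **Path lifting for the orbit map of a finite group action** (Brown, *Topology and
Groupoids*, 11.1.4; Bredon, *Introduction to Compact Transformation Groups*, II.6.2): if a finite
group `G` acts by homeomorphisms on a Hausdorff space `X`, then for every path `γ` in the orbit
space `X/G` and every `x₀` over its initial point there is a path `Γ` in `X` from `x₀` with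
`p ∘ Γ = γ`. [cite: Brown2006, 11.1.4] -/
theorem exists_path_lift [Finite G] [ContinuousConstSMul G X] [T2Space X] {x₀ : X}
    {q : orbitRel.Quotient G X} (γ : Path (⟦x₀⟧ : orbitRel.Quotient G X) q) :
    ∃ (x₁ : X) (Γ : Path x₀ x₁), ∀ t, (⟦Γ t⟧ : orbitRel.Quotient G X) = γ t := by
  obtain ⟨f, hfc, hf0, hfl⟩ := exists_lift_Icc (G := G) γ.extend (c := 0) (d := 1)
    γ.continuous_extend.continuousOn (x₀ := x₀) (by rw [γ.extend_zero])
  refine ⟨f 1, ⟨⟨fun t => f t, hfc.comp_continuous continuous_subtype_val fun t => t.2⟩, hf0, rfl⟩,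
    fun t => ?_⟩
  show (⟦f t⟧ : orbitRel.Quotient G X) = γ t
  rw [hfl t t.2, γ.extend_extends']

end OrbitMapPathLifting

end Literature.AlgebraicTopology.FundamentalGroup
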